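import Literature.AnabelianGeometry.SemiGraphs.TemperedArithmeticGroupOfOpenSubgroup

/-!
# [SemiAnbd] Ex. 3.10 for a covering `X_U → X_K`: the augmentation `aug|_U : U ↠ G_K` is OPEN when `aug` is (pp. 43–45)

Mochizuki, *Semi-graphs of anabelioids*, Publ. RIMS **42** (2006) 221–322, Ex. 3.10 pp.43–45; §6 p.69 ("`1 → Δ^temp_X → Π^temp_{X_K}
→ G_K → 1`") [cite: MochizukiSemiAnbd2006, Ex 3.10 p.43].  abc-iut cell, layer L2/L3 plumbing (seat abc-iut-w4-d008, gen 4);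
PROOF-ONLY companion (0 definitions) of abc-iut-L2-t4's `TemperedArithmeticGroupOfOpenSubgroup.lean` (p433008).

WHY.  abc-iut-L2-t4's junction `ThetaFrobenioid.ofThetaSettingData` (`Discharge/Sec5OfThetaSetting.lean`) reads the [EtTh] §5 data on
the Ex. 3.10 datum `X := TemperedCurve.temperedArithmeticGroupOfOpenSubgroup … C.Huu …` of the open subgroup `Π^tp_X̲̲ ⊆ Π^tp_X`; this
seat's origin-clause file `Discharge/Sec5OriginClausesOfPushforward.lean` (p433787) forms the [FrdII] Ex. 1.3 (ii) push-forward along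
`X.aug` and therefore carries the binder `haug : IsOpenMap X.aug`.  Here that binder is REDUCED to the Setting-level hypothesis of
record `IsOpenMap D.aug` (`D.aug : Π^temp → G_{ℚ_p}`; the hypothesis of abc-iut-L2's `isOpenMap_augTheta`, PROVED at the models:
`isOpenMap_aug_modelχ`, `isOpenMap_augχ`): an open map stays open after co-restriction to its (open) image `G_K` and the identification
`G_K ≃ Gal(K̄/K)`, and after restriction to an OPEN subgroup `U` (the inclusion of an open subset is an open map).
* `TemperedCurve.isOpenMap_augGK`, `isOpenMap_augK` — `Π^temp ↠ G_K` and `augK ι = ι ∘ augGK` are open if `aug` is;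
* `TemperedArithmeticGroup.isOpenMap_augOfSubgroup`, `isOpenMap_aug_ofOpenSubgroup` — `aug|_U` is open for `U` open;
* `TemperedCurve.isOpenMap_aug_temperedArithmeticGroupOfOpenSubgroup` — the curve-level composite.
HONEST FRAMING: elementary topology over abc-iut-L3's interfaces; no statement of the papers is strengthened; nothing here bears on
[IUTchIII] Cor. 3.12.
-/

noncomputable section

namespace Literature.AnabelianGeometry.SemiGraphs

open Topology

universe u

namespace TemperedArithmeticGroup

variable {K : Type u} [Field K] (X : TemperedArithmeticGroup K) (U : Subgroup X.Pi)

/-- `aug|_U : U → Gal(K̄/K)` is an open map when `aug` is and `U` is open (the inclusion `U ⊆ Π` of an open subset is an open map).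
[cite: MochizukiSemiAnbd2006, Ex 3.10 p.43] -/
theorem isOpenMap_augOfSubgroup (hU : IsOpen (U : Set X.Pi)) (h : IsOpenMap X.aug) : IsOpenMap (X.augOfSubgroup U) :=
  h.comp hU.isOpenMap_subtype_val

/-- The augmentation of the Ex. 3.10 datum `X.ofOpenSubgroup U hU haug` of an open subgroup is an open map when `X.aug` is.
[cite: MochizukiSemiAnbd2006, Ex 3.10 p.43] -/
theorem isOpenMap_aug_ofOpenSubgroup (hU : IsOpen (U : Set X.Pi)) (haug : U.map X.aug.toMonoidHom = ⊤) (h : IsOpenMap X.aug) :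
    IsOpenMap (X.ofOpenSubgroup U hU haug).aug :=
  X.isOpenMap_augOfSubgroup U hU h

end TemperedArithmeticGroup

namespace TemperedCurve

variable {p : ℕ} [Fact p.Prime] (X : TemperedCurve p)

/-- `augGK : Π^temp_{X_K} ↠ G_K` (the augmentation co-restricted to its image `G_K ≤ G_{ℚ_p}`) is an open map when
`aug : Π^temp → G_{ℚ_p}` is.  [cite: MochizukiSemiAnbd2006, §6 p.69] -/
theorem isOpenMap_augGK (h : IsOpenMap X.aug) : IsOpenMap X.augGK :=
  h.codRestrict _

/-- `augK ι = ι ∘ augGK : Π^temp_{X_K} ↠ Gal(K̄/K)` is an open map when `aug` is (`ι` a homeomorphism).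
[cite: MochizukiSemiAnbd2006, §6 p.69] -/
theorem isOpenMap_augK (ι : X.GK ≃ₜ* Field.absoluteGaloisGroup X.K) (h : IsOpenMap X.aug) : IsOpenMap (X.augK ι) :=
  ι.toHomeomorph.isOpenMap.comp (X.isOpenMap_augGK h)

/-- **The augmentation of the Ex. 3.10 datum of a covering `X_U → X_K` (`U ⊆ Π^temp` open, `aug(U) = G_K`) is an OPEN MAP when the
curve's `aug : Π^temp → G_{ℚ_p}` is** — the binder `haug : IsOpenMap X.aug` of `Discharge/Sec5OriginClausesOfPushforward.lean` at
abc-iut-L2-t4's junction datum, reduced to the Setting-level hypothesis of record `IsOpenMap D.aug`.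
[cite: MochizukiSemiAnbd2006, Ex 3.10 p.43] -/
theorem isOpenMap_aug_temperedArithmeticGroupOfOpenSubgroup (d : X.GroupLevelData) (U : Subgroup X.PiTemp)
    (hU : IsOpen (U : Set X.PiTemp)) (haug : U.map X.aug.toMonoidHom = X.GK) (h : IsOpenMap X.aug) :
    IsOpenMap (X.temperedArithmeticGroupOfOpenSubgroup d U hU haug).aug :=
  (X.toTemperedArithmeticGroup d).isOpenMap_augOfSubgroup U hU (X.isOpenMap_augK d.galEquiv h)

end TemperedCurve

end Literature.AnabelianGeometry.SemiGraphs

end
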